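import Summits.Ventures.HodgeRepro.Tier4.Line1.LocalWitt
import Summits.Ventures.HodgeRepro.Tier4.Line1.RationalRotation
import Summits.Ventures.HodgeRepro.Tier4.Line1.C7Components

/-!
# Tier4/Line1/LocalWittPlace — LINE L1: local Witt at every place, in the `localU` / `localUInf` vocabulary (C7.1 / C7.1∞)

Blind re-derivation cell `pub-hodge-repro`, Tier 4 (README §9–§10), seat t4-L1-p4 (g2), LINE L1, rung C7 of the R-c cut.
The field-generic Witt theorem of `LocalWitt` (`Rot.exists_isometry_mulVec_eq_of_det_ne_zero`, column picture) is
transported along a field embedding `φ : k →+* F` and read in the ROW convention of typer-2's `unitaryGroup`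
(`g Ω = Ω g`, `g B gᵀ = B`), then specialised to `F = k_v` (`localU`, `finRat`) and `F = k_w` (`localUInf`, `infRat`):

* `exists_unitary_map_vecMul_eq`: for a genuine definite plane `W` (`IsGenuineRow`, `IsDefinite`), a non-zero rational
  row vector `v₀` and ANY `x ∈ F⁴` with `x B_F xᵀ = v₀ B_F v₀ᵀ`, some `h ∈ U(W)(F)` has `v₀ h = x`.  The hypotheses of the
  generic theorem are supplied by transport: `B_Fᵀ = B_F` (`B_symm`), `Ω_F² = −φ(d)` and `Ω_F B_F = −B_F Ω_Fᵀ`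
  (`IsGenuineRow`, `Matrix.map_mul`), `det B_F = φ(det B) ≠ 0` (`isUnit_B_of_isDefinite`, `RingHom.map_det`), `φ(d) ≠ 0`
  (`¬ IsSquare (−d)`), and `v₀ B_F v₀ᵀ = φ(v₀ B v₀ᵀ) ≠ 0` (`pair_self_ne_zero_of_isDefinite`); `CharZero F` from the
  injectivity of `φ`.
* `exists_mem_localU_vecMul_eq` / `exists_mem_localUInf_vecMul_eq`: the same at a finite place `v` / an infinite place `w`
  — EXACTLY the local-Witt hypothesis `hwitt` displayed by t4-L1-p1's `exists_compact_stab_mul_of_transitive`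
  (LocalFibration p672938) and t4-L1-p2's C7LocalWitt consumer; the second sphere equation (`(xΩ) B xᵀ = (v₀Ω) B v₀ᵀ`)
  of the census statement is accepted and unused (it holds automatically: `β(x, xΩ) = 0`).

Nothing here says anything about the status of the Hodge conjecture for CM abelian varieties, which is NOT proved
(HC_CM is NOT proved by anyone in this repository).
-/

set_option autoImplicit false

noncomputable section

namespace Summit.Ventures.HodgeRepro.Tier4.Line1

open NumberField IsDedekindDomain HeightOneSpectrum Summit.Ventures.HodgeRepro.Tier4.Common Matrix

variable {k : Type} [Field k] [NumberField k] (W : PlaneData k)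

section Transport

variable {F : Type} [Field F] (φ : k →+* F)

omit [NumberField k] in
/-- **Local Witt along a field embedding `φ : k →+* F`, row convention**: for a genuine definite plane, a non-zero rational
`v₀` and any `x ∈ F⁴` of the same `B_F`-norm, some `h` with `h Ω_F = Ω_F h`, `h B_F hᵀ = B_F` has `v₀ h = x`. -/
theorem exists_unitary_map_vecMul_eq [CharZero k] (hg : IsGenuineRow W) (hW : IsDefinite W)
    {v₀ : Fin 4 → k} (hv₀ : v₀ ≠ 0) {x : Fin 4 → F}
    (hx : x ᵥ* W.B.map φ ⬝ᵥ x = (fun i => φ (v₀ i)) ᵥ* W.B.map φ ⬝ᵥ (fun i => φ (v₀ i))) :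
    ∃ h : Matrix (Fin 4) (Fin 4) F, h * W.Ω.map φ = W.Ω.map φ * h ∧ h * W.B.map φ * hᵀ = W.B.map φ ∧
      (fun i => φ (v₀ i)) ᵥ* h = x := by
  haveI : CharZero F := (RingHom.charZero_iff φ.injective).mp inferInstance
  obtain ⟨⟨d, hΩ, hd⟩, hrow, -, -, -, -⟩ := hg
  have hd0 : d ≠ 0 := by
    rintro rfl
    exact hd ⟨0, by simp⟩
  -- the transported data
  have hBfT : (W.B.map φ)ᵀ = W.B.map φ := by rw [← Matrix.transpose_map, W.B_symm]
  have hΩf2 : W.Ω.map φ * W.Ω.map φ = -((φ d) • (1 : Matrix (Fin 4) (Fin 4) F)) := by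
    rw [← Matrix.map_mul, hΩ, Matrix.map_neg φ (map_neg φ), Matrix.map_smul' φ d _ (map_mul φ),
      Matrix.map_one φ (map_zero φ) (map_one φ)]
  have hrowf : W.Ω.map φ * W.B.map φ = -(W.B.map φ * (W.Ω.map φ)ᵀ) := by
    rw [← Matrix.map_mul, hrow, Matrix.map_neg φ (map_neg φ), Matrix.map_mul, Matrix.transpose_map]
  -- the column picture: `Om := Ω_Fᵀ`
  have hOm : (W.Ω.map φ)ᵀ * (W.Ω.map φ)ᵀ = -((φ d) • (1 : Matrix (Fin 4) (Fin 4) F)) := by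
    rw [← Matrix.transpose_mul, hΩf2, Matrix.transpose_neg, Matrix.transpose_smul, Matrix.transpose_one]
  have hherm : (W.Ω.map φ)ᵀᵀ * W.B.map φ = -(W.B.map φ * (W.Ω.map φ)ᵀ) := by
    rw [Matrix.transpose_transpose]
    exact hrowf
  have hBdet : (W.B.map φ).det ≠ 0 := by
    rw [← RingHom.mapMatrix_apply, ← RingHom.map_det]
    exact (map_ne_zero φ).mpr
      ((Matrix.isUnit_iff_isUnit_det W.B).mp (isUnit_B_of_isDefinite W hW)).ne_zero
  have hd0f : φ d ≠ 0 := (map_ne_zero φ).mpr hd0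
  have hα : (fun i => φ (v₀ i)) ⬝ᵥ (W.B.map φ *ᵥ fun i => φ (v₀ i)) ≠ 0 := by
    have e : φ (v₀ ⬝ᵥ (W.B *ᵥ v₀)) = (fun i => φ (v₀ i)) ⬝ᵥ (W.B.map φ *ᵥ fun i => φ (v₀ i)) := by
      rw [RingHom.map_dotProduct]
      congr 1
      funext i
      exact RingHom.map_mulVec φ W.B v₀ i
    rw [← e]
    exact (map_ne_zero φ).mpr (pair_self_ne_zero_of_isDefinite W hW hv₀)
  have e' : ∀ v : Fin 4 → F, v ᵥ* W.B.map φ ⬝ᵥ v = v ⬝ᵥ (W.B.map φ *ᵥ v) := fun v => by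
    rw [← mulVec_transpose, hBfT, dotProduct_comm]
  have hxy : (fun i => φ (v₀ i)) ⬝ᵥ (W.B.map φ *ᵥ fun i => φ (v₀ i)) = x ⬝ᵥ (W.B.map φ *ᵥ x) := by
    rw [← e', ← e']
    exact hx.symm
  obtain ⟨h, hhOm, hhB, -, hhx⟩ :=
    Rot.exists_isometry_mulVec_eq_of_det_ne_zero hBfT hherm hOm hd0f hBdet hα hxy
  refine ⟨hᵀ, ?_, ?_, ?_⟩
  · rw [← Matrix.transpose_transpose (W.Ω.map φ), ← Matrix.transpose_mul, ← Matrix.transpose_mul, hhOm]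
  · rw [Matrix.transpose_transpose]
    exact hhB
  · rw [vecMul_transpose, hhx]

end Transport

section Places

/-- **LOCAL WITT AT A FINITE PLACE** (the `hwitt` of C7.1): for a genuine definite plane, a non-zero rational `v₀` and
any `x ∈ k_v⁴` on the sphere of `v₀` (`x B_v xᵀ = v₀ B_v v₀ᵀ`; the second equation `(xΩ_v) B_v xᵀ = (v₀Ω_v) B_v v₀ᵀ`
of the census statement is accepted and unused), some `h ∈ U(W)(k_v)` has `v₀ h = x`. -/
theorem exists_mem_localU_vecMul_eq (hg : IsGenuineRow W) (hW : IsDefinite W)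
    (v : HeightOneSpectrum (𝓞 k)) {v₀ : Fin 4 → k} (hv₀ : v₀ ≠ 0) (x : Fin 4 → v.adicCompletion k)
    (hx : x ᵥ* W.B.map (algebraMap k (v.adicCompletion k)) ⬝ᵥ x =
      finRat v v₀ ᵥ* W.B.map (algebraMap k (v.adicCompletion k)) ⬝ᵥ finRat v v₀)
    (_hxΩ : (x ᵥ* W.Ω.map (algebraMap k (v.adicCompletion k))) ᵥ*
        W.B.map (algebraMap k (v.adicCompletion k)) ⬝ᵥ x =
      (finRat v v₀ ᵥ* W.Ω.map (algebraMap k (v.adicCompletion k))) ᵥ*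
        W.B.map (algebraMap k (v.adicCompletion k)) ⬝ᵥ finRat v v₀) :
    ∃ h ∈ localU W v, finRat v v₀ ᵥ* h = x := by
  obtain ⟨h, h1, h2, h3⟩ :=
    exists_unitary_map_vecMul_eq W (algebraMap k (v.adicCompletion k)) hg hW hv₀ (x := x) hx
  exact ⟨h, ⟨h1, h2⟩, h3⟩

/-- **LOCAL WITT AT AN INFINITE PLACE** (the `hwitt` of C7.1∞): the same over `k_w`. -/
theorem exists_mem_localUInf_vecMul_eq (hg : IsGenuineRow W) (hW : IsDefinite W)
    (w : InfinitePlace k) {v₀ : Fin 4 → k} (hv₀ : v₀ ≠ 0) (x : Fin 4 → w.Completion)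
    (hx : x ᵥ* W.B.map (algebraMap k w.Completion) ⬝ᵥ x =
      infRat w v₀ ᵥ* W.B.map (algebraMap k w.Completion) ⬝ᵥ infRat w v₀)
    (_hxΩ : (x ᵥ* W.Ω.map (algebraMap k w.Completion)) ᵥ* W.B.map (algebraMap k w.Completion) ⬝ᵥ x =
      (infRat w v₀ ᵥ* W.Ω.map (algebraMap k w.Completion)) ᵥ*
        W.B.map (algebraMap k w.Completion) ⬝ᵥ infRat w v₀) :
    ∃ h ∈ localUInf W w, infRat w v₀ ᵥ* h = x := by
  obtain ⟨h, h1, h2, h3⟩ :=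
    exists_unitary_map_vecMul_eq W (algebraMap k w.Completion) hg hW hv₀ (x := x) hx
  exact ⟨h, ⟨h1, h2⟩, h3⟩

end Places

end Summit.Ventures.HodgeRepro.Tier4.Line1

end
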